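import Summits.AtomisticToContinuum.Crystallization.Theorems.FrustratedLawDichotomyTextureCoarseTransfer
import Summits.AtomisticToContinuum.Crystallization.Theorems.FrustratedLawDichotomyPalmFrequency

/-!
# FrustratedLawDichotomy · crux `AperiodicFrustratedLawGap` (stmt-AtomisticToContinuum-27623) — TEXTURE TRANSFER IV: COARSE SITES
# (decomp-a2c, prover hand 1, direct share, generation 6)

Clause (5) of the crux's texture — «in the `R₉`-ball of every site: some `1/20`-good site, or a coarse MAJORITY, or a coarse TETRAHEDRAL
site» — is the icosahedral / Frank–Kasper content of the texture.  Together with clause (2) (all sites `1/20`-bad) it gives a COARSE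
(not `1/8`-good) site within `R₉` of every site of the approximant (`exists_coarse_site`).  This file transfers that to the charged
configuration and to the law:

* `coarse_near_of_texture` — deterministic: a rooted `δ`-hard-core configuration texture-charged in the sense of clause (d) (separation,
  clauses (2) and (5), two-way matching) has, within `R₉` of EVERY atom `p`, an atom `p₁` that is NOT ROBUSTLY `1/8`-GOOD (fcc nor hcp; for
  no scale, tolerance `< 1/8`, gap, isometry and shell labelling).  Matchings of radius `|R₉| + n` and tolerance `1/(n+2)` each produce a
  matched coarse atom in the finite set of atoms within `R₉ + 1` of `p` (`not_goodEighth_of_coarse_matched` refutes every robust goodness the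
  matching resolves); one atom serves infinitely many `n` (pigeonhole), hence all parameters.
* `ae_coarse_near_of_texture` — law level, the crux's `let`s VERBATIM.
* `inv_le_prob_coarseRoot` — THE COARSE-SITE FREQUENCY: `∀ δ > 0 ∀ R₉ ∃ C ∀ P` probability + (a) + (b) + (d): every measurable set containing
  all configurations whose ROOT is not robustly `1/8`-good has Palm probability `≥ 1/C(δ, R₉)` (`measure_univ_le_mul_of_ubiquitous`).
  With the fine-site frequency (`FrustratedLawDichotomyFrustrationFrequency`) this quantifies the «fcc-like matrix with coarse nodules within
  `R₉` of everyone» picture of the crux's world: both kinds of sites have positive Palm frequency, uniformly over the class.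

All `[folklore]`.  No definitions, no `sorry`.
-/

noncomputable section

namespace Summit.AtomisticToContinuum.Crystallization.Theorems.FrustratedLawDichotomyTextureCoarseSites

open MeasureTheory Metric Set Filter
open scoped ENNReal
open Literature.Probability.Process Literature.Geometry.DiscreteGeometry
open Summit.AtomisticToContinuum.Crystallization.Theorems.FrustratedLawDichotomyTextureCoarseCore (exists_coarse_site)
open Summit.AtomisticToContinuum.Crystallization.Theorems.FrustratedLawDichotomyTextureCoarseTransfer (not_goodEighth_of_coarse_matched)
open Summit.AtomisticToContinuum.Crystallization.Theorems.FrustratedLawDichotomyTextureFineShells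
  (fccKissingPattern_nonempty hcpKissingPattern_nonempty)
open Summit.AtomisticToContinuum.Crystallization.Theorems.FrustratedLawDichotomyPalmFrequency
  (measure_univ_le_mul_of_ubiquitous map_sub_apply_singleton)
open Literature.Probability.Process.LocalConfig (finite_inter_of_separated)

/-! ## §1. Coarse atoms within `R₉` of every atom (deterministic) -/

/-- Arithmetic of the pigeonhole step: a natural number above `80/(d(1−8η)) + 10/γ + 8/δ + 2d + γ + 15` resolves all five bounds at
tolerance `1/(n+2)`. [folklore] -/
theorem bounds_of_large {d η γ δ : ℝ} (hd : 0 < d) (hη : η < 1 / 8) (hγ : 0 < γ) (hδ : 0 < δ) {n : ℕ}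
    (hn : 80 / (d * (1 - 8 * η)) + 10 / γ + 8 / δ + 2 * d + γ + 15 ≤ (n : ℝ)) :
    80 * (1 / ((n : ℝ) + 2)) ≤ d * (1 - 8 * η) ∧ 10 * (1 / ((n : ℝ) + 2)) ≤ γ ∧ 8 * (1 / ((n : ℝ) + 2)) < δ ∧
      8 * (1 / ((n : ℝ) + 2)) < 7 / 10 ∧ 2 * d + γ + 2 ≤ (n : ℝ) - 1 := by
  have hη0 : 0 < d * (1 - 8 * η) := by nlinarith
  have hn2 : (0 : ℝ) < (n : ℝ) + 2 := by positivity
  have h80 : 0 < 80 / (d * (1 - 8 * η)) := by positivity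
  have h10 : 0 < 10 / γ := by positivity
  have h8 : 0 < 8 / δ := by positivity
  have hA : 80 / (d * (1 - 8 * η)) ≤ (n : ℝ) + 2 := by linarith
  have hB : 10 / γ ≤ (n : ℝ) + 2 := by linarith
  have hC : 8 / δ < (n : ℝ) + 2 := by linarith
  refine ⟨?_, ?_, ?_, ?_, by linarith⟩
  · rw [← mul_div_assoc, mul_one, div_le_iff₀ hn2]
    calc (80 : ℝ) = 80 / (d * (1 - 8 * η)) * (d * (1 - 8 * η)) := (div_mul_cancel₀ (80 : ℝ) (ne_of_gt hη0)).symm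
      _ ≤ ((n : ℝ) + 2) * (d * (1 - 8 * η)) := by gcongr
      _ = d * (1 - 8 * η) * ((n : ℝ) + 2) := by ring
  · rw [← mul_div_assoc, mul_one, div_le_iff₀ hn2]
    calc (10 : ℝ) = 10 / γ * γ := (div_mul_cancel₀ (10 : ℝ) hγ.ne').symm
      _ ≤ ((n : ℝ) + 2) * γ := by gcongr
      _ = γ * ((n : ℝ) + 2) := by ring
  · rw [← mul_div_assoc, mul_one, div_lt_iff₀ hn2]
    calc (8 : ℝ) = 8 / δ * δ := (div_mul_cancel₀ (8 : ℝ) hδ.ne').symm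
      _ < ((n : ℝ) + 2) * δ := by gcongr
      _ = δ * ((n : ℝ) + 2) := by ring
  · rw [← mul_div_assoc, mul_one, div_lt_iff₀ hn2]
    linarith

/-- **COARSE ATOMS ARE `R₉`-DENSE in a texture-charged configuration (deterministic).**  See the module docstring. [folklore] -/
theorem coarse_near_of_texture {δ : ℝ} (hδ : 0 < δ) {μ : Measure (EuclideanSpace ℝ (Fin 3))} (hμ : IsRootedHardCore δ μ) {R₉ : ℝ}
    (h : ∀ q : EuclideanSpace ℝ (Fin 3), μ {q} ≠ 0 → ∀ R ε : ℝ, 0 < ε → ∃ (N : ℕ) (y : Fin N → EuclideanSpace ℝ (Fin 3)) (i : Fin N),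
      (∀ a b : Fin N, a ≠ b → (7 : ℝ) / 10 ≤ dist (y a) (y b)) ∧
      (∀ j : Fin N, dist (y j) (y i) ≤ R → ¬ ∃ A : EuclideanSpace ℝ (Fin 3) →ₗᵢ[ℝ] EuclideanSpace ℝ (Fin 3),
          (∃ e : ↥{z : EuclideanSpace ℝ (Fin 3) | z ∈ Set.range y ∧ z ≠ y j ∧ dist z (y j) < 13 / 10 * sInf ((fun z => dist z (y j)) '' (Set.range y \ {y j}))} ≃ ↥Literature.Geometry.DiscreteGeometry.fccKissingPattern, ∀ t : ↥{z : EuclideanSpace ℝ (Fin 3) | z ∈ Set.range y ∧ z ≠ y j ∧ dist z (y j) < 13 / 10 * sInf ((fun z => dist z (y j)) '' (Set.range y \ {y j}))}, dist ((sInf ((fun z => dist z (y j)) '' (Set.range y \ {y j})))⁻¹ • ((t : EuclideanSpace ℝ (Fin 3)) - y j)) (A ((e t : ↥Literature.Geometry.DiscreteGeometry.fccKissingPattern) : EuclideanSpace ℝ (Fin 3))) ≤ 1 / 20) ∨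
          (∃ e : ↥{z : EuclideanSpace ℝ (Fin 3) | z ∈ Set.range y ∧ z ≠ y j ∧ dist z (y j) < 13 / 10 * sInf ((fun z => dist z (y j)) '' (Set.range y \ {y j}))} ≃ ↥Literature.Geometry.DiscreteGeometry.hcpKissingPattern, ∀ t : ↥{z : EuclideanSpace ℝ (Fin 3) | z ∈ Set.range y ∧ z ≠ y j ∧ dist z (y j) < 13 / 10 * sInf ((fun z => dist z (y j)) '' (Set.range y \ {y j}))}, dist ((sInf ((fun z => dist z (y j)) '' (Set.range y \ {y j})))⁻¹ • ((t : EuclideanSpace ℝ (Fin 3)) - y j)) (A ((e t : ↥Literature.Geometry.DiscreteGeometry.hcpKissingPattern) : EuclideanSpace ℝ (Fin 3))) ≤ 1 / 20)) ∧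
      (∀ j : Fin N, dist (y j) (y i) ≤ R → ¬ ((∀ j' : Fin N, dist (y j') (y j) ≤ R₉ → ¬ ∃ A : EuclideanSpace ℝ (Fin 3) →ₗᵢ[ℝ] EuclideanSpace ℝ (Fin 3),
          (∃ e : ↥{z : EuclideanSpace ℝ (Fin 3) | z ∈ Set.range y ∧ z ≠ y j' ∧ dist z (y j') < 13 / 10 * sInf ((fun z => dist z (y j')) '' (Set.range y \ {y j'}))} ≃ ↥Literature.Geometry.DiscreteGeometry.fccKissingPattern, ∀ t : ↥{z : EuclideanSpace ℝ (Fin 3) | z ∈ Set.range y ∧ z ≠ y j' ∧ dist z (y j') < 13 / 10 * sInf ((fun z => dist z (y j')) '' (Set.range y \ {y j'}))}, dist ((sInf ((fun z => dist z (y j')) '' (Set.range y \ {y j'})))⁻¹ • ((t : EuclideanSpace ℝ (Fin 3)) - y j')) (A ((e t : ↥Literature.Geometry.DiscreteGeometry.fccKissingPattern) : EuclideanSpace ℝ (Fin 3))) ≤ 1 / 20) ∨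
          (∃ e : ↥{z : EuclideanSpace ℝ (Fin 3) | z ∈ Set.range y ∧ z ≠ y j' ∧ dist z (y j') < 13 / 10 * sInf ((fun z => dist z (y j')) '' (Set.range y \ {y j'}))} ≃ ↥Literature.Geometry.DiscreteGeometry.hcpKissingPattern, ∀ t : ↥{z : EuclideanSpace ℝ (Fin 3) | z ∈ Set.range y ∧ z ≠ y j' ∧ dist z (y j') < 13 / 10 * sInf ((fun z => dist z (y j')) '' (Set.range y \ {y j'}))}, dist ((sInf ((fun z => dist z (y j')) '' (Set.range y \ {y j'})))⁻¹ • ((t : EuclideanSpace ℝ (Fin 3)) - y j')) (A ((e t : ↥Literature.Geometry.DiscreteGeometry.hcpKissingPattern) : EuclideanSpace ℝ (Fin 3))) ≤ 1 / 20)) ∧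
        (Nat.card {j' : Fin N // dist (y j') (y j) ≤ R₉ ∧ ¬ ∃ A : EuclideanSpace ℝ (Fin 3) →ₗᵢ[ℝ] EuclideanSpace ℝ (Fin 3),
          (∃ e : ↥{z : EuclideanSpace ℝ (Fin 3) | z ∈ Set.range y ∧ z ≠ y j' ∧ dist z (y j') < 13 / 10 * sInf ((fun z => dist z (y j')) '' (Set.range y \ {y j'}))} ≃ ↥Literature.Geometry.DiscreteGeometry.fccKissingPattern, ∀ t : ↥{z : EuclideanSpace ℝ (Fin 3) | z ∈ Set.range y ∧ z ≠ y j' ∧ dist z (y j') < 13 / 10 * sInf ((fun z => dist z (y j')) '' (Set.range y \ {y j'}))}, dist ((sInf ((fun z => dist z (y j')) '' (Set.range y \ {y j'})))⁻¹ • ((t : EuclideanSpace ℝ (Fin 3)) - y j')) (A ((e t : ↥Literature.Geometry.DiscreteGeometry.fccKissingPattern) : EuclideanSpace ℝ (Fin 3))) ≤ 1 / 8) ∨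
          (∃ e : ↥{z : EuclideanSpace ℝ (Fin 3) | z ∈ Set.range y ∧ z ≠ y j' ∧ dist z (y j') < 13 / 10 * sInf ((fun z => dist z (y j')) '' (Set.range y \ {y j'}))} ≃ ↥Literature.Geometry.DiscreteGeometry.hcpKissingPattern, ∀ t : ↥{z : EuclideanSpace ℝ (Fin 3) | z ∈ Set.range y ∧ z ≠ y j' ∧ dist z (y j') < 13 / 10 * sInf ((fun z => dist z (y j')) '' (Set.range y \ {y j'}))}, dist ((sInf ((fun z => dist z (y j')) '' (Set.range y \ {y j'})))⁻¹ • ((t : EuclideanSpace ℝ (Fin 3)) - y j')) (A ((e t : ↥Literature.Geometry.DiscreteGeometry.hcpKissingPattern) : EuclideanSpace ℝ (Fin 3))) ≤ 1 / 8)} : ℝ) ≤ 1 / 2 * (Nat.card {j' : Fin N // dist (y j') (y j) ≤ R₉} : ℝ) ∧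
        (∀ j' : Fin N, dist (y j') (y j) ≤ R₉ → ¬ (∃ A : EuclideanSpace ℝ (Fin 3) →ₗᵢ[ℝ] EuclideanSpace ℝ (Fin 3),
          (∃ e : ↥{z : EuclideanSpace ℝ (Fin 3) | z ∈ Set.range y ∧ z ≠ y j' ∧ dist z (y j') < 13 / 10 * sInf ((fun z => dist z (y j')) '' (Set.range y \ {y j'}))} ≃ ↥Literature.Geometry.DiscreteGeometry.fccKissingPattern, ∀ t : ↥{z : EuclideanSpace ℝ (Fin 3) | z ∈ Set.range y ∧ z ≠ y j' ∧ dist z (y j') < 13 / 10 * sInf ((fun z => dist z (y j')) '' (Set.range y \ {y j'}))}, dist ((sInf ((fun z => dist z (y j')) '' (Set.range y \ {y j'})))⁻¹ • ((t : EuclideanSpace ℝ (Fin 3)) - y j')) (A ((e t : ↥Literature.Geometry.DiscreteGeometry.fccKissingPattern) : EuclideanSpace ℝ (Fin 3))) ≤ 1 / 8) ∨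
          (∃ e : ↥{z : EuclideanSpace ℝ (Fin 3) | z ∈ Set.range y ∧ z ≠ y j' ∧ dist z (y j') < 13 / 10 * sInf ((fun z => dist z (y j')) '' (Set.range y \ {y j'}))} ≃ ↥Literature.Geometry.DiscreteGeometry.hcpKissingPattern, ∀ t : ↥{z : EuclideanSpace ℝ (Fin 3) | z ∈ Set.range y ∧ z ≠ y j' ∧ dist z (y j') < 13 / 10 * sInf ((fun z => dist z (y j')) '' (Set.range y \ {y j'}))}, dist ((sInf ((fun z => dist z (y j')) '' (Set.range y \ {y j'})))⁻¹ • ((t : EuclideanSpace ℝ (Fin 3)) - y j')) (A ((e t : ↥Literature.Geometry.DiscreteGeometry.hcpKissingPattern) : EuclideanSpace ℝ (Fin 3))) ≤ 1 / 8)) → ¬ (∀ k : Fin N, y k ≠ y j' → dist (y k) (y j') < 27 / 20 * sInf ((fun z => dist z (y j')) '' (Set.range y \ {y j'})) →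
          5 ≤ Nat.card {m : Fin N // y m ≠ y j' ∧ dist (y m) (y j') < 27 / 20 * sInf ((fun z => dist z (y j')) '' (Set.range y \ {y j'})) ∧ y m ≠ y k ∧ dist (y m) (y k) < 27 / 20 * sInf ((fun z => dist z (y j')) '' (Set.range y \ {y j'}))})))) ∧
      (∀ s : EuclideanSpace ℝ (Fin 3), μ {s} ≠ 0 → dist s q ≤ R → ∃ a : Fin N, dist (y a - y i) (s - q) ≤ ε) ∧
      (∀ a : Fin N, dist (y a) (y i) ≤ R → ∃ s : EuclideanSpace ℝ (Fin 3), μ {s} ≠ 0 ∧ dist (y a - y i) (s - q) ≤ ε))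
    {p : EuclideanSpace ℝ (Fin 3)} (hp : μ {p} ≠ 0) :
    ∃ p₁ : EuclideanSpace ℝ (Fin 3), μ {p₁} ≠ 0 ∧ dist p₁ p ≤ R₉ ∧
      (∀ (d η γ : ℝ) (A : EuclideanSpace ℝ (Fin 3) →ₗᵢ[ℝ] EuclideanSpace ℝ (Fin 3)),
      (∀ t : ↥Literature.Geometry.DiscreteGeometry.fccKissingPattern → EuclideanSpace ℝ (Fin 3),
        ¬ (0 < d ∧ 0 < γ ∧ η < 1 / 8 ∧
          (∀ u : ↥Literature.Geometry.DiscreteGeometry.fccKissingPattern, μ {t u} ≠ 0 ∧ ‖(t u - p₁) - d • A (u : EuclideanSpace ℝ (Fin 3))‖ ≤ η * d) ∧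
          (∀ s : EuclideanSpace ℝ (Fin 3), μ {s} ≠ 0 → s ≠ p₁ → d ≤ dist s p₁) ∧
          (∃ s : EuclideanSpace ℝ (Fin 3), μ {s} ≠ 0 ∧ s ≠ p₁ ∧ dist s p₁ ≤ d) ∧
          (∀ s : EuclideanSpace ℝ (Fin 3), μ {s} ≠ 0 → s ≠ p₁ → dist s p₁ < 13 / 10 * d + γ → dist s p₁ ≤ 13 / 10 * d - γ ∧ s ∈ Set.range t))) ∧
      (∀ t : ↥Literature.Geometry.DiscreteGeometry.hcpKissingPattern → EuclideanSpace ℝ (Fin 3),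
        ¬ (0 < d ∧ 0 < γ ∧ η < 1 / 8 ∧
          (∀ u : ↥Literature.Geometry.DiscreteGeometry.hcpKissingPattern, μ {t u} ≠ 0 ∧ ‖(t u - p₁) - d • A (u : EuclideanSpace ℝ (Fin 3))‖ ≤ η * d) ∧
          (∀ s : EuclideanSpace ℝ (Fin 3), μ {s} ≠ 0 → s ≠ p₁ → d ≤ dist s p₁) ∧
          (∃ s : EuclideanSpace ℝ (Fin 3), μ {s} ≠ 0 ∧ s ≠ p₁ ∧ dist s p₁ ≤ d) ∧
          (∀ s : EuclideanSpace ℝ (Fin 3), μ {s} ≠ 0 → s ≠ p₁ → dist s p₁ < 13 / 10 * d + γ → dist s p₁ ≤ 13 / 10 * d - γ ∧ s ∈ Set.range t)))) := by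
  classical
  obtain ⟨S, -, hS, rfl⟩ := hμ
  have hmem : ∀ q : EuclideanSpace ℝ (Fin 3), (Measure.count : Measure (EuclideanSpace ℝ (Fin 3))).restrict S {q} ≠ 0 ↔ q ∈ S :=
    count_restrict_singleton_ne_zero_iff S
  have hpS : p ∈ S := (hmem p).1 hp
  -- the finite set of candidates
  have hfin : (closedBall p (R₉ + 1) ∩ S).Finite := finite_inter_of_separated hδ hS (isCompact_closedBall p (R₉ + 1))
  haveI : Finite ↥(closedBall p (R₉ + 1) ∩ S) := hfin.to_subtype
  -- one matched coarse atom per `n`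
  have hstep : ∀ n : ℕ, ∃ q : ↥(closedBall p (R₉ + 1) ∩ S), dist (q : EuclideanSpace ℝ (Fin 3)) p ≤ R₉ + 1 / ((n : ℝ) + 2) ∧
      ∀ (d η γ : ℝ) (A : EuclideanSpace ℝ (Fin 3) →ₗᵢ[ℝ] EuclideanSpace ℝ (Fin 3)),
        80 * (1 / ((n : ℝ) + 2)) ≤ d * (1 - 8 * η) → 10 * (1 / ((n : ℝ) + 2)) ≤ γ → 8 * (1 / ((n : ℝ) + 2)) < δ →
        8 * (1 / ((n : ℝ) + 2)) < 7 / 10 → 2 * d + γ + 2 ≤ (n : ℝ) - 1 →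
        (∀ t : ↥Literature.Geometry.DiscreteGeometry.fccKissingPattern → EuclideanSpace ℝ (Fin 3), ¬ (0 < d ∧ 0 < γ ∧ η < 1 / 8 ∧
          (∀ u : ↥Literature.Geometry.DiscreteGeometry.fccKissingPattern, t u ∈ S ∧ ‖(t u - (q : EuclideanSpace ℝ (Fin 3))) - d • A (u : EuclideanSpace ℝ (Fin 3))‖ ≤ η * d) ∧
          (∀ s : EuclideanSpace ℝ (Fin 3), s ∈ S → s ≠ (q : EuclideanSpace ℝ (Fin 3)) → d ≤ dist s (q : EuclideanSpace ℝ (Fin 3))) ∧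
          (∃ s : EuclideanSpace ℝ (Fin 3), s ∈ S ∧ s ≠ (q : EuclideanSpace ℝ (Fin 3)) ∧ dist s (q : EuclideanSpace ℝ (Fin 3)) ≤ d) ∧
          (∀ s : EuclideanSpace ℝ (Fin 3), s ∈ S → s ≠ (q : EuclideanSpace ℝ (Fin 3)) → dist s (q : EuclideanSpace ℝ (Fin 3)) < 13 / 10 * d + γ → dist s (q : EuclideanSpace ℝ (Fin 3)) ≤ 13 / 10 * d - γ ∧ s ∈ Set.range t))) ∧
        (∀ t : ↥Literature.Geometry.DiscreteGeometry.hcpKissingPattern → EuclideanSpace ℝ (Fin 3), ¬ (0 < d ∧ 0 < γ ∧ η < 1 / 8 ∧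
          (∀ u : ↥Literature.Geometry.DiscreteGeometry.hcpKissingPattern, t u ∈ S ∧ ‖(t u - (q : EuclideanSpace ℝ (Fin 3))) - d • A (u : EuclideanSpace ℝ (Fin 3))‖ ≤ η * d) ∧
          (∀ s : EuclideanSpace ℝ (Fin 3), s ∈ S → s ≠ (q : EuclideanSpace ℝ (Fin 3)) → d ≤ dist s (q : EuclideanSpace ℝ (Fin 3))) ∧
          (∃ s : EuclideanSpace ℝ (Fin 3), s ∈ S ∧ s ≠ (q : EuclideanSpace ℝ (Fin 3)) ∧ dist s (q : EuclideanSpace ℝ (Fin 3)) ≤ d) ∧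
          (∀ s : EuclideanSpace ℝ (Fin 3), s ∈ S → s ≠ (q : EuclideanSpace ℝ (Fin 3)) → dist s (q : EuclideanSpace ℝ (Fin 3)) < 13 / 10 * d + γ → dist s (q : EuclideanSpace ℝ (Fin 3)) ≤ 13 / 10 * d - γ ∧ s ∈ Set.range t))) := by
    intro n
    set ε : ℝ := 1 / ((n : ℝ) + 2) with hε
    have hε0 : 0 < ε := by rw [hε]; positivity
    have hε1 : ε ≤ 1 := by
      rw [hε, div_le_iff₀ (by positivity)]
      have : (0 : ℝ) ≤ n := Nat.cast_nonneg n
      linarith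
    set R : ℝ := |R₉| + n with hR
    have hR₉R : R₉ ≤ R := by rw [hR]; linarith [le_abs_self R₉, (Nat.cast_nonneg n : (0 : ℝ) ≤ n)]
    obtain ⟨N, y, i, hsepY, hcl2, hcl5, hm1, hm2⟩ := h p hp R ε hε0
    have hm1' : ∀ s ∈ S, dist s p ≤ R → ∃ a : Fin N, dist (y a - y i) (s - p) ≤ ε := fun s hs => hm1 s ((hmem s).2 hs)
    have hm2' : ∀ a : Fin N, dist (y a) (y i) ≤ R → ∃ s ∈ S, dist (y a - y i) (s - p) ≤ ε := fun a ha => by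
      obtain ⟨s, hs, h'⟩ := hm2 a ha
      exact ⟨s, (hmem s).1 hs, h'⟩
    -- a coarse site within `R₉` of the centre (clauses (2) + (5) at the centre)
    have hR0 : dist (y i) (y i) ≤ R := by rw [dist_self]; exact le_trans (le_trans (le_refl _) (abs_nonneg R₉)) (by rw [hR]; linarith [(Nat.cast_nonneg n : (0 : ℝ) ≤ n)])
    obtain ⟨j', hj'R₉, hcoarse⟩ := exists_coarse_site y i hR₉R
      (fun j => ∃ A : EuclideanSpace ℝ (Fin 3) →ₗᵢ[ℝ] EuclideanSpace ℝ (Fin 3),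
          (∃ e : ↥{z : EuclideanSpace ℝ (Fin 3) | z ∈ Set.range y ∧ z ≠ y j ∧ dist z (y j) < 13 / 10 * sInf ((fun z => dist z (y j)) '' (Set.range y \ {y j}))} ≃ ↥Literature.Geometry.DiscreteGeometry.fccKissingPattern, ∀ t : ↥{z : EuclideanSpace ℝ (Fin 3) | z ∈ Set.range y ∧ z ≠ y j ∧ dist z (y j) < 13 / 10 * sInf ((fun z => dist z (y j)) '' (Set.range y \ {y j}))}, dist ((sInf ((fun z => dist z (y j)) '' (Set.range y \ {y j})))⁻¹ • ((t : EuclideanSpace ℝ (Fin 3)) - y j)) (A ((e t : ↥Literature.Geometry.DiscreteGeometry.fccKissingPattern) : EuclideanSpace ℝ (Fin 3))) ≤ 1 / 20) ∨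
          (∃ e : ↥{z : EuclideanSpace ℝ (Fin 3) | z ∈ Set.range y ∧ z ≠ y j ∧ dist z (y j) < 13 / 10 * sInf ((fun z => dist z (y j)) '' (Set.range y \ {y j}))} ≃ ↥Literature.Geometry.DiscreteGeometry.hcpKissingPattern, ∀ t : ↥{z : EuclideanSpace ℝ (Fin 3) | z ∈ Set.range y ∧ z ≠ y j ∧ dist z (y j) < 13 / 10 * sInf ((fun z => dist z (y j)) '' (Set.range y \ {y j}))}, dist ((sInf ((fun z => dist z (y j)) '' (Set.range y \ {y j})))⁻¹ • ((t : EuclideanSpace ℝ (Fin 3)) - y j)) (A ((e t : ↥Literature.Geometry.DiscreteGeometry.hcpKissingPattern) : EuclideanSpace ℝ (Fin 3))) ≤ 1 / 20))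
      (fun j' => ∃ A : EuclideanSpace ℝ (Fin 3) →ₗᵢ[ℝ] EuclideanSpace ℝ (Fin 3),
          (∃ e : ↥{z : EuclideanSpace ℝ (Fin 3) | z ∈ Set.range y ∧ z ≠ y j' ∧ dist z (y j') < 13 / 10 * sInf ((fun z => dist z (y j')) '' (Set.range y \ {y j'}))} ≃ ↥Literature.Geometry.DiscreteGeometry.fccKissingPattern, ∀ t : ↥{z : EuclideanSpace ℝ (Fin 3) | z ∈ Set.range y ∧ z ≠ y j' ∧ dist z (y j') < 13 / 10 * sInf ((fun z => dist z (y j')) '' (Set.range y \ {y j'}))}, dist ((sInf ((fun z => dist z (y j')) '' (Set.range y \ {y j'})))⁻¹ • ((t : EuclideanSpace ℝ (Fin 3)) - y j')) (A ((e t : ↥Literature.Geometry.DiscreteGeometry.fccKissingPattern) : EuclideanSpace ℝ (Fin 3))) ≤ 1 / 8) ∨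
          (∃ e : ↥{z : EuclideanSpace ℝ (Fin 3) | z ∈ Set.range y ∧ z ≠ y j' ∧ dist z (y j') < 13 / 10 * sInf ((fun z => dist z (y j')) '' (Set.range y \ {y j'}))} ≃ ↥Literature.Geometry.DiscreteGeometry.hcpKissingPattern, ∀ t : ↥{z : EuclideanSpace ℝ (Fin 3) | z ∈ Set.range y ∧ z ≠ y j' ∧ dist z (y j') < 13 / 10 * sInf ((fun z => dist z (y j')) '' (Set.range y \ {y j'}))}, dist ((sInf ((fun z => dist z (y j')) '' (Set.range y \ {y j'})))⁻¹ • ((t : EuclideanSpace ℝ (Fin 3)) - y j')) (A ((e t : ↥Literature.Geometry.DiscreteGeometry.hcpKissingPattern) : EuclideanSpace ℝ (Fin 3))) ≤ 1 / 8))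
      (fun j' => (∀ k : Fin N, y k ≠ y j' → dist (y k) (y j') < 27 / 20 * sInf ((fun z => dist z (y j')) '' (Set.range y \ {y j'})) →
          5 ≤ Nat.card {m : Fin N // y m ≠ y j' ∧ dist (y m) (y j') < 27 / 20 * sInf ((fun z => dist z (y j')) '' (Set.range y \ {y j'})) ∧ y m ≠ y k ∧ dist (y m) (y k) < 27 / 20 * sInf ((fun z => dist z (y j')) '' (Set.range y \ {y j'}))}))
      hcl2 (hcl5 i hR0)
    -- its matched atom
    obtain ⟨p₁, hp₁S, hj'⟩ := hm2' j' (hj'R₉.trans hR₉R)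
    have hp₁p : dist p₁ p ≤ R₉ + ε := by
      have h1 : ‖(p₁ - p) - (y j' - y i)‖ ≤ ε := by rw [← dist_eq_norm, dist_comm]; exact hj'
      calc dist p₁ p = ‖(y j' - y i) + ((p₁ - p) - (y j' - y i))‖ := by rw [dist_eq_norm]; congr 1; abel
        _ ≤ ‖y j' - y i‖ + ‖(p₁ - p) - (y j' - y i)‖ := norm_add_le _ _
        _ ≤ R₉ + ε := add_le_add (by rw [← dist_eq_norm]; exact hj'R₉) h1
    have hp₁F : p₁ ∈ closedBall p (R₉ + 1) ∩ S := ⟨by rw [mem_closedBall]; linarith, hp₁S⟩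
    refine ⟨⟨p₁, hp₁F⟩, hp₁p, fun d η γ A hεη hεγ hεδ hε7 hRd => ?_⟩
    have hcoarse' : ∀ (Pat : Finset (EuclideanSpace ℝ (Fin 3))), (Pat = Literature.Geometry.DiscreteGeometry.fccKissingPattern ∨ Pat = Literature.Geometry.DiscreteGeometry.hcpKissingPattern) →
        ¬ ∃ e : ↥{z : EuclideanSpace ℝ (Fin 3) | z ∈ Set.range y ∧ z ≠ y j' ∧ dist z (y j') < 13 / 10 * sInf ((fun z => dist z (y j')) '' (Set.range y \ {y j'}))} ≃ ↥Pat, ∀ z : ↥{z : EuclideanSpace ℝ (Fin 3) | z ∈ Set.range y ∧ z ≠ y j' ∧ dist z (y j') < 13 / 10 * sInf ((fun z => dist z (y j')) '' (Set.range y \ {y j'}))},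
          dist ((sInf ((fun z => dist z (y j')) '' (Set.range y \ {y j'})))⁻¹ • ((z : EuclideanSpace ℝ (Fin 3)) - y j')) (A ((e z : ↥Pat) : EuclideanSpace ℝ (Fin 3))) ≤ 1 / 8 := by
      rintro Pat (rfl | rfl) ⟨e, he⟩
      · exact hcoarse ⟨A, Or.inl ⟨e, he⟩⟩
      · exact hcoarse ⟨A, Or.inr ⟨e, he⟩⟩
    have hRd' : 2 * d + γ + 2 ≤ R - R₉ - ε := by
      rw [hR]; linarith [le_abs_self R₉]
    exact ⟨fun t => not_goodEighth_of_coarse_matched hS hsepY hm1' hm2' hp₁S hj' hj'R₉ fccKissingPattern_nonempty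
          (fun u hu => norm_eq_one_of_mem_fccKissingPattern hu) (fun u hu u' hu' hne => one_le_dist_of_mem_fccKissingPattern hu hu' hne)
          (hcoarse' _ (Or.inl rfl)) hε0 hεη hεγ hεδ hε7 hRd',
      fun t => not_goodEighth_of_coarse_matched hS hsepY hm1' hm2' hp₁S hj' hj'R₉ hcpKissingPattern_nonempty
          (fun u hu => norm_eq_one_of_mem_hcpKissingPattern hu) (fun u hu u' hu' hne => one_le_dist_of_mem_hcpKissingPattern hu hu' hne)
          (hcoarse' _ (Or.inr rfl)) hε0 hεη hεγ hεδ hε7 hRd'⟩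
  -- pigeonhole: one candidate serves infinitely many `n`
  choose f hf using hstep
  obtain ⟨q, hq⟩ := Finite.exists_infinite_fiber f
  have hinf : (f ⁻¹' {q}).Infinite := Set.infinite_coe_iff.mp hq
  refine ⟨(q : EuclideanSpace ℝ (Fin 3)), (hmem _).2 q.2.2, ?_, ?_⟩
  · -- `dist q p ≤ R₉ + 1/(n+2)` along the fibre
    refine le_of_forall_pos_lt_add fun ε₀ hε₀ => ?_
    obtain ⟨n, hn, hnN⟩ := hinf.exists_gt ⌈1 / ε₀⌉₊
    have hfn : f n = q := hn
    have h1 := (hf n).1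
    rw [hfn] at h1
    have h2 : 1 / ((n : ℝ) + 2) < ε₀ := by
      rw [div_lt_iff₀ (by positivity)]
      have h3 : (⌈1 / ε₀⌉₊ : ℝ) < n := by exact_mod_cast hnN
      have h4 : 1 / ε₀ ≤ (⌈1 / ε₀⌉₊ : ℝ) := Nat.le_ceil _
      have h5 : 1 / ε₀ * ε₀ = 1 := by field_simp
      nlinarith
    linarith
  · intro d η γ A
    -- convert an atom-form tuple into the `S`-form refuted along the fibre
    have key : ∀ (Pat : Finset (EuclideanSpace ℝ (Fin 3))) (t : ↥Pat → EuclideanSpace ℝ (Fin 3)),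
        (0 < d ∧ 0 < γ ∧ η < 1 / 8 ∧
          (∀ u : ↥Pat, (Measure.count : Measure (EuclideanSpace ℝ (Fin 3))).restrict S {t u} ≠ 0 ∧ ‖(t u - (q : EuclideanSpace ℝ (Fin 3))) - d • A (u : EuclideanSpace ℝ (Fin 3))‖ ≤ η * d) ∧
          (∀ s : EuclideanSpace ℝ (Fin 3), (Measure.count : Measure (EuclideanSpace ℝ (Fin 3))).restrict S {s} ≠ 0 → s ≠ (q : EuclideanSpace ℝ (Fin 3)) → d ≤ dist s (q : EuclideanSpace ℝ (Fin 3))) ∧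
          (∃ s : EuclideanSpace ℝ (Fin 3), (Measure.count : Measure (EuclideanSpace ℝ (Fin 3))).restrict S {s} ≠ 0 ∧ s ≠ (q : EuclideanSpace ℝ (Fin 3)) ∧ dist s (q : EuclideanSpace ℝ (Fin 3)) ≤ d) ∧
          (∀ s : EuclideanSpace ℝ (Fin 3), (Measure.count : Measure (EuclideanSpace ℝ (Fin 3))).restrict S {s} ≠ 0 → s ≠ (q : EuclideanSpace ℝ (Fin 3)) → dist s (q : EuclideanSpace ℝ (Fin 3)) < 13 / 10 * d + γ → dist s (q : EuclideanSpace ℝ (Fin 3)) ≤ 13 / 10 * d - γ ∧ s ∈ Set.range t)) →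
        (0 < d ∧ 0 < γ ∧ η < 1 / 8 ∧
          (∀ u : ↥Pat, t u ∈ S ∧ ‖(t u - (q : EuclideanSpace ℝ (Fin 3))) - d • A (u : EuclideanSpace ℝ (Fin 3))‖ ≤ η * d) ∧
          (∀ s : EuclideanSpace ℝ (Fin 3), s ∈ S → s ≠ (q : EuclideanSpace ℝ (Fin 3)) → d ≤ dist s (q : EuclideanSpace ℝ (Fin 3))) ∧
          (∃ s : EuclideanSpace ℝ (Fin 3), s ∈ S ∧ s ≠ (q : EuclideanSpace ℝ (Fin 3)) ∧ dist s (q : EuclideanSpace ℝ (Fin 3)) ≤ d) ∧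
          (∀ s : EuclideanSpace ℝ (Fin 3), s ∈ S → s ≠ (q : EuclideanSpace ℝ (Fin 3)) → dist s (q : EuclideanSpace ℝ (Fin 3)) < 13 / 10 * d + γ → dist s (q : EuclideanSpace ℝ (Fin 3)) ≤ 13 / 10 * d - γ ∧ s ∈ Set.range t)) := by
      intro Pat t ht
      obtain ⟨hd, hγ, hη, ht, hnn₁, hnn₂, hgap⟩ := ht
      refine ⟨hd, hγ, hη, fun u => ⟨(hmem _).1 (ht u).1, (ht u).2⟩, fun s hs => hnn₁ s ((hmem s).2 hs), ?_,
        fun s hs => hgap s ((hmem s).2 hs)⟩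
      obtain ⟨s, hs, h1, h2⟩ := hnn₂
      exact ⟨s, (hmem s).1 hs, h1, h2⟩
    -- a large `n` in the fibre
    have pick : ∀ {Pat : Finset (EuclideanSpace ℝ (Fin 3))} (t : ↥Pat → EuclideanSpace ℝ (Fin 3)),
        (0 < d ∧ 0 < γ ∧ η < 1 / 8 ∧
          (∀ u : ↥Pat, t u ∈ S ∧ ‖(t u - (q : EuclideanSpace ℝ (Fin 3))) - d • A (u : EuclideanSpace ℝ (Fin 3))‖ ≤ η * d) ∧
          (∀ s : EuclideanSpace ℝ (Fin 3), s ∈ S → s ≠ (q : EuclideanSpace ℝ (Fin 3)) → d ≤ dist s (q : EuclideanSpace ℝ (Fin 3))) ∧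
          (∃ s : EuclideanSpace ℝ (Fin 3), s ∈ S ∧ s ≠ (q : EuclideanSpace ℝ (Fin 3)) ∧ dist s (q : EuclideanSpace ℝ (Fin 3)) ≤ d) ∧
          (∀ s : EuclideanSpace ℝ (Fin 3), s ∈ S → s ≠ (q : EuclideanSpace ℝ (Fin 3)) → dist s (q : EuclideanSpace ℝ (Fin 3)) < 13 / 10 * d + γ → dist s (q : EuclideanSpace ℝ (Fin 3)) ≤ 13 / 10 * d - γ ∧ s ∈ Set.range t)) →
        ∃ n : ℕ, f n = q ∧ 80 * (1 / ((n : ℝ) + 2)) ≤ d * (1 - 8 * η) ∧ 10 * (1 / ((n : ℝ) + 2)) ≤ γ ∧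
          8 * (1 / ((n : ℝ) + 2)) < δ ∧ 8 * (1 / ((n : ℝ) + 2)) < 7 / 10 ∧ 2 * d + γ + 2 ≤ (n : ℝ) - 1 := by
      intro Pat t ht
      obtain ⟨hd, hγ, hη, -⟩ := ht
      obtain ⟨n, hn, hnN⟩ := hinf.exists_gt ⌈80 / (d * (1 - 8 * η)) + 10 / γ + 8 / δ + 2 * d + γ + 15⌉₊
      have hn' : 80 / (d * (1 - 8 * η)) + 10 / γ + 8 / δ + 2 * d + γ + 15 ≤ (n : ℝ) := by
        have h3 : (⌈80 / (d * (1 - 8 * η)) + 10 / γ + 8 / δ + 2 * d + γ + 15⌉₊ : ℝ) < n := by exact_mod_cast hnN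
        exact le_trans (Nat.le_ceil _) h3.le
      exact ⟨n, hn, bounds_of_large hd hη hγ hδ hn'⟩
    constructor
    · intro t ht
      have ht' := key _ t ht
      obtain ⟨n, hfn, b1, b2, b3, b4, b5⟩ := pick t ht'
      have h1 := ((hf n).2 d η γ A b1 b2 b3 b4 b5).1 t
      rw [hfn] at h1
      exact h1 ht'
    · intro t ht
      have ht' := key _ t ht
      obtain ⟨n, hfn, b1, b2, b3, b4, b5⟩ := pick t ht'
      have h1 := ((hf n).2 d η γ A b1 b2 b3 b4 b5).2 t
      rw [hfn] at h1
      exact h1 ht'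

/-! ## §2. Law level, the crux's `let`s verbatim -/

/-- **Clauses (a) + (d) of the crux ⟹ almost surely a coarse atom within `R₉` of every atom** (the crux's `let`-bound `Gy` / `TexBall` /
`Appr` VERBATIM; `coarse_near_of_texture` with clauses (2), (5) and the matching projected out of `TexBall`). [folklore] -/
theorem ae_coarse_near_of_texture :
    ∀ P : MeasureTheory.Measure (MeasureTheory.Measure (EuclideanSpace ℝ (Fin 3))), let Gy : ℝ → (N : ℕ) → (Fin N → EuclideanSpace ℝ (Fin 3)) → Fin N → Prop := fun η N y j => let d : ℝ := sInf ((fun z => dist z (y (j : Fin N))) '' (Set.range (y) \ {(y (j : Fin N))})); let T : Set (EuclideanSpace ℝ (Fin 3)) := {z : EuclideanSpace ℝ (Fin 3) | z ∈ Set.range (y) ∧ z ≠ (y (j : Fin N)) ∧ dist z (y (j : Fin N)) < 13 / 10 * d}; ∃ A : EuclideanSpace ℝ (Fin 3) →ₗᵢ[ℝ] EuclideanSpace ℝ (Fin 3), (∃ e : ↥T ≃ ↥Literature.Geometry.DiscreteGeometry.fccKissingPattern, ∀ t : ↥T, dist (d⁻¹ • ((t : EuclideanSpace ℝ (Fin 3))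 - (y (j : Fin N)))) (A ((e t : ↥Literature.Geometry.DiscreteGeometry.fccKissingPattern) : EuclideanSpace ℝ (Fin 3))) ≤ η) ∨ (∃ e : ↥T ≃ ↥Literature.Geometry.DiscreteGeometry.hcpKissingPattern, ∀ t : ↥T, dist (d⁻¹ • ((t : EuclideanSpace ℝ (Fin 3)) - (y (j : Fin N)))) (A ((e t : ↥Literature.Geometry.DiscreteGeometry.hcpKissingPattern) : EuclideanSpace ℝ (Fin 3))) ≤ η); let TexBall : (N : ℕ) → (Fin N → EuclideanSpace ℝ (Fin 3)) → Fin N → ℝ → ℝ → ℝ → ℝ → Prop := fun N y i R R₇ R₈ R₉ => (∀ a b : Fin N, a ≠ b → (7 : ℝ) / 10 ≤ dist (y a) (y b)) ∧ (∀ j : Fin N, dist (y j) (y i) ≤ R → ¬ Gy (1 / 20) N (y) j) ∧ (∀ j : Fin N, dist (y j) (y i) ≤ R → ¬ ((∀ j' : Fin N, dist (y j') (y j) ≤ R₇ → ¬ Gy (1 / 20) N (y) j') ∧ (∀ z : EuclideanSpace ℝ (Fin 3), dist z (y j) ≤ R₇ → ∃ k : Fin N, dist z (y k) ≤ 1) ∧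 (∀ j' : Fin N, dist (y j') (y j) ≤ R₇ → (let d : ℝ := sInf ((fun z => dist z (y j')) '' (Set.range (y) \ {(y j')})); ∀ k : Fin N, y k ≠ y j' → dist (y k) (y j') < 27 / 20 * d → 5 ≤ Nat.card {m : Fin N // y m ≠ y j' ∧ dist (y m) (y j') < 27 / 20 * d ∧ y m ≠ y k ∧ dist (y m) (y k) < 27 / 20 * d})))) ∧ (∀ j : Fin N, dist (y j) (y i) ≤ R → ∃ k : Fin N, dist (y k) (y j) ≤ R₈ ∧ Gy (1 / 8) N (y) k) ∧ (∀ j : Fin N, dist (y j) (y i) ≤ R → ¬ ((∀ j' : Fin N, dist (y j') (y j) ≤ R₉ → ¬ Gy (1 / 20) N (y) j') ∧ (Nat.card {j' : Fin N // dist (y j') (y j) ≤ R₉ ∧ ¬ Gy (1 / 8) N (y) j'} : ℝ) ≤ 1 / 2 * (Nat.card {j' : Fin N // dist (y j') (y j) ≤ R₉} : ℝ) ∧ (∀ j' : Fin N, dist (y j') (y j) ≤ R₉ → ¬ Gy (1 / 8) N (y) j' → ¬ (let d : ℝ := sInf ((fun z => dist z (y j')) '' (Set.range (y) \ {(y j')}));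 ∀ k : Fin N, y k ≠ y j' → dist (y k) (y j') < 27 / 20 * d → 5 ≤ Nat.card {m : Fin N // y m ≠ y j' ∧ dist (y m) (y j') < 27 / 20 * d ∧ y m ≠ y k ∧ dist (y m) (y k) < 27 / 20 * d})))); let Appr : MeasureTheory.Measure (EuclideanSpace ℝ (Fin 3)) → ℝ → ℝ → ℝ → Prop := fun μ R₇ R₈ R₉ => ∀ q : EuclideanSpace ℝ (Fin 3), μ {q} ≠ 0 → ∀ R ε : ℝ, 0 < ε → ∃ (N : ℕ) (y : Fin N → EuclideanSpace ℝ (Fin 3)) (i : Fin N), TexBall N y i R R₇ R₈ R₉ ∧ (∀ p : EuclideanSpace ℝ (Fin 3), μ {p} ≠ 0 → dist p q ≤ R → ∃ k : Fin N, dist (y k - y i) (p - q) ≤ ε) ∧ (∀ k : Fin N, dist (y k) (y i) ≤ R → ∃ p : EuclideanSpace ℝ (Fin 3), μ {p} ≠ 0 ∧ dist (y k - y i) (p - q) ≤ ε);  ∀ δ : ℝ, 0 < δ → (∀ᵐ μ ∂P, Literature.Probability.Process.IsRootedHardCore δ μ) → ∀ R₇ R₈ R₉ : ℝ, (∀ᵐ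 μ ∂P, Appr μ R₇ R₈ R₉) →
      ∀ᵐ μ ∂P, ∀ p : EuclideanSpace ℝ (Fin 3), μ {p} ≠ 0 → ∃ p₁ : EuclideanSpace ℝ (Fin 3), μ {p₁} ≠ 0 ∧ dist p₁ p ≤ R₉ ∧
        (∀ (d η γ : ℝ) (A : EuclideanSpace ℝ (Fin 3) →ₗᵢ[ℝ] EuclideanSpace ℝ (Fin 3)),
      (∀ t : ↥Literature.Geometry.DiscreteGeometry.fccKissingPattern → EuclideanSpace ℝ (Fin 3),
        ¬ (0 < d ∧ 0 < γ ∧ η < 1 / 8 ∧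
          (∀ u : ↥Literature.Geometry.DiscreteGeometry.fccKissingPattern, μ {t u} ≠ 0 ∧ ‖(t u - p₁) - d • A (u : EuclideanSpace ℝ (Fin 3))‖ ≤ η * d) ∧
          (∀ s : EuclideanSpace ℝ (Fin 3), μ {s} ≠ 0 → s ≠ p₁ → d ≤ dist s p₁) ∧
          (∃ s : EuclideanSpace ℝ (Fin 3), μ {s} ≠ 0 ∧ s ≠ p₁ ∧ dist s p₁ ≤ d) ∧
          (∀ s : EuclideanSpace ℝ (Fin 3), μ {s} ≠ 0 → s ≠ p₁ → dist s p₁ < 13 / 10 * d + γ → dist s p₁ ≤ 13 / 10 * d - γ ∧ s ∈ Set.range t))) ∧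
      (∀ t : ↥Literature.Geometry.DiscreteGeometry.hcpKissingPattern → EuclideanSpace ℝ (Fin 3),
        ¬ (0 < d ∧ 0 < γ ∧ η < 1 / 8 ∧
          (∀ u : ↥Literature.Geometry.DiscreteGeometry.hcpKissingPattern, μ {t u} ≠ 0 ∧ ‖(t u - p₁) - d • A (u : EuclideanSpace ℝ (Fin 3))‖ ≤ η * d) ∧
          (∀ s : EuclideanSpace ℝ (Fin 3), μ {s} ≠ 0 → s ≠ p₁ → d ≤ dist s p₁) ∧
          (∃ s : EuclideanSpace ℝ (Fin 3), μ {s} ≠ 0 ∧ s ≠ p₁ ∧ dist s p₁ ≤ d) ∧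
          (∀ s : EuclideanSpace ℝ (Fin 3), μ {s} ≠ 0 → s ≠ p₁ → dist s p₁ < 13 / 10 * d + γ → dist s p₁ ≤ 13 / 10 * d - γ ∧ s ∈ Set.range t)))) := by
  intro P
  dsimp only
  intro δ hδ ha R₇ R₈ R₉ hd
  filter_upwards [ha, hd] with μ hμ hμ' p hp
  exact coarse_near_of_texture hδ hμ (R₉ := R₉) (fun q hq R ε hε => by
    obtain ⟨N, y, i, ⟨hsep, h2, -, -, h5⟩, hm1, hm2⟩ := hμ' q hq R ε hε
    exact ⟨N, y, i, hsep, h2, h5, hm1, hm2⟩) hp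

/-! ## §3. The coarse-site Palm frequency -/

/-- Shifting a robustly `η`-good shell (`η < 1/8`) of the re-rooted configuration back to `μ` at `p` (the `1/8`-threshold twin of
`FrustratedLawDichotomyFrustrationFrequency.robustGood_shift`). [folklore] -/
theorem robustGoodEighth_shift (μ : Measure (EuclideanSpace ℝ (Fin 3))) (p : EuclideanSpace ℝ (Fin 3)) {K : Finset (EuclideanSpace ℝ (Fin 3))} {d η γ : ℝ}
    {A : EuclideanSpace ℝ (Fin 3) →ₗᵢ[ℝ] EuclideanSpace ℝ (Fin 3)} {t : ↥K → EuclideanSpace ℝ (Fin 3)}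
    (ht : (0 < d ∧ 0 < γ ∧ η < 1 / 8 ∧
          (∀ u : ↥K, (μ.map fun z : EuclideanSpace ℝ (Fin 3) => z - p) {t u} ≠ 0 ∧ ‖(t u - 0) - d • A (u : EuclideanSpace ℝ (Fin 3))‖ ≤ η * d) ∧
          (∀ s : EuclideanSpace ℝ (Fin 3), (μ.map fun z : EuclideanSpace ℝ (Fin 3) => z - p) {s} ≠ 0 → s ≠ 0 → d ≤ dist s 0) ∧
          (∃ s : EuclideanSpace ℝ (Fin 3), (μ.map fun z : EuclideanSpace ℝ (Fin 3) => z - p) {s} ≠ 0 ∧ s ≠ 0 ∧ dist s 0 ≤ d) ∧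
          (∀ s : EuclideanSpace ℝ (Fin 3), (μ.map fun z : EuclideanSpace ℝ (Fin 3) => z - p) {s} ≠ 0 → s ≠ 0 → dist s 0 < 13 / 10 * d + γ → dist s 0 ≤ 13 / 10 * d - γ ∧ s ∈ Set.range t))) :
    (0 < d ∧ 0 < γ ∧ η < 1 / 8 ∧
          (∀ u : ↥K, μ {(fun u => t u + p) u} ≠ 0 ∧ ‖((fun u => t u + p) u - p) - d • A (u : EuclideanSpace ℝ (Fin 3))‖ ≤ η * d) ∧
          (∀ s : EuclideanSpace ℝ (Fin 3), μ {s} ≠ 0 → s ≠ p → d ≤ dist s p) ∧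
          (∃ s : EuclideanSpace ℝ (Fin 3), μ {s} ≠ 0 ∧ s ≠ p ∧ dist s p ≤ d) ∧
          (∀ s : EuclideanSpace ℝ (Fin 3), μ {s} ≠ 0 → s ≠ p → dist s p < 13 / 10 * d + γ → dist s p ≤ 13 / 10 * d - γ ∧ s ∈ Set.range (fun u => t u + p))) := by
  have hat : ∀ s : EuclideanSpace ℝ (Fin 3), (μ.map fun z : EuclideanSpace ℝ (Fin 3) => z - p) {s} ≠ 0 ↔ μ {s + p} ≠ 0 := fun s => by
    rw [map_sub_apply_singleton]
  have hdist : ∀ s : EuclideanSpace ℝ (Fin 3), dist (s - p) 0 = dist s p := fun s => by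
    rw [dist_zero_right, dist_eq_norm]
  obtain ⟨hd, hγ, hη, h1, h2, h3, h4⟩ := ht
  refine ⟨hd, hγ, hη, fun u => ?_, fun s hs hsp => ?_, ?_, fun s hs hsp hlt => ?_⟩
  · obtain ⟨hu, hn⟩ := h1 u
    refine ⟨(hat _).1 hu, ?_⟩
    simpa only [sub_zero, add_sub_cancel_right] using hn
  · have hs' : (μ.map fun z : EuclideanSpace ℝ (Fin 3) => z - p) {s - p} ≠ 0 := by rw [hat, sub_add_cancel]; exact hs
    have h := h2 (s - p) hs' (sub_ne_zero.2 hsp)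
    rwa [hdist] at h
  · obtain ⟨s, hs, hs0, hsd⟩ := h3
    refine ⟨s + p, (hat s).1 hs, fun h => hs0 (by simpa using congrArg (· - p) h), ?_⟩
    have : dist (s + p) p = dist s 0 := by rw [dist_zero_right, dist_eq_norm, add_sub_cancel_right]
    rw [this]; exact hsd
  · have hs' : (μ.map fun z : EuclideanSpace ℝ (Fin 3) => z - p) {s - p} ≠ 0 := by rw [hat, sub_add_cancel]; exact hs
    have hlt' : dist (s - p) 0 < 13 / 10 * d + γ := by rw [hdist]; exact hlt
    obtain ⟨hle, u, hu⟩ := h4 (s - p) hs' (sub_ne_zero.2 hsp) hlt'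
    refine ⟨by rw [← hdist]; exact hle, u, ?_⟩
    show t u + p = s
    rw [hu, sub_add_cancel]

/-- Re-rooting the «not robustly `1/8`-good» test from the atom `p` of `μ` to the root of `θ_p μ`. [folklore] -/
theorem notRobustGoodEighth_reroot {μ : Measure (EuclideanSpace ℝ (Fin 3))} {p : EuclideanSpace ℝ (Fin 3)}
    (h : (∀ (d η γ : ℝ) (A : EuclideanSpace ℝ (Fin 3) →ₗᵢ[ℝ] EuclideanSpace ℝ (Fin 3)),
      (∀ t : ↥Literature.Geometry.DiscreteGeometry.fccKissingPattern → EuclideanSpace ℝ (Fin 3),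
        ¬ (0 < d ∧ 0 < γ ∧ η < 1 / 8 ∧
          (∀ u : ↥Literature.Geometry.DiscreteGeometry.fccKissingPattern, μ {t u} ≠ 0 ∧ ‖(t u - p) - d • A (u : EuclideanSpace ℝ (Fin 3))‖ ≤ η * d) ∧
          (∀ s : EuclideanSpace ℝ (Fin 3), μ {s} ≠ 0 → s ≠ p → d ≤ dist s p) ∧
          (∃ s : EuclideanSpace ℝ (Fin 3), μ {s} ≠ 0 ∧ s ≠ p ∧ dist s p ≤ d) ∧
          (∀ s : EuclideanSpace ℝ (Fin 3), μ {s} ≠ 0 → s ≠ p → dist s p < 13 / 10 * d + γ → dist s p ≤ 13 / 10 * d - γ ∧ s ∈ Set.range t))) ∧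
      (∀ t : ↥Literature.Geometry.DiscreteGeometry.hcpKissingPattern → EuclideanSpace ℝ (Fin 3),
        ¬ (0 < d ∧ 0 < γ ∧ η < 1 / 8 ∧
          (∀ u : ↥Literature.Geometry.DiscreteGeometry.hcpKissingPattern, μ {t u} ≠ 0 ∧ ‖(t u - p) - d • A (u : EuclideanSpace ℝ (Fin 3))‖ ≤ η * d) ∧
          (∀ s : EuclideanSpace ℝ (Fin 3), μ {s} ≠ 0 → s ≠ p → d ≤ dist s p) ∧
          (∃ s : EuclideanSpace ℝ (Fin 3), μ {s} ≠ 0 ∧ s ≠ p ∧ dist s p ≤ d) ∧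
          (∀ s : EuclideanSpace ℝ (Fin 3), μ {s} ≠ 0 → s ≠ p → dist s p < 13 / 10 * d + γ → dist s p ≤ 13 / 10 * d - γ ∧ s ∈ Set.range t))))) :
    (∀ (d η γ : ℝ) (A : EuclideanSpace ℝ (Fin 3) →ₗᵢ[ℝ] EuclideanSpace ℝ (Fin 3)),
      (∀ t : ↥Literature.Geometry.DiscreteGeometry.fccKissingPattern → EuclideanSpace ℝ (Fin 3),
        ¬ (0 < d ∧ 0 < γ ∧ η < 1 / 8 ∧
          (∀ u : ↥Literature.Geometry.DiscreteGeometry.fccKissingPattern, (μ.map fun z : EuclideanSpace ℝ (Fin 3) => z - p) {t u} ≠ 0 ∧ ‖(t u - 0) - d • A (u : EuclideanSpace ℝ (Fin 3))‖ ≤ η * d) ∧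
          (∀ s : EuclideanSpace ℝ (Fin 3), (μ.map fun z : EuclideanSpace ℝ (Fin 3) => z - p) {s} ≠ 0 → s ≠ 0 → d ≤ dist s 0) ∧
          (∃ s : EuclideanSpace ℝ (Fin 3), (μ.map fun z : EuclideanSpace ℝ (Fin 3) => z - p) {s} ≠ 0 ∧ s ≠ 0 ∧ dist s 0 ≤ d) ∧
          (∀ s : EuclideanSpace ℝ (Fin 3), (μ.map fun z : EuclideanSpace ℝ (Fin 3) => z - p) {s} ≠ 0 → s ≠ 0 → dist s 0 < 13 / 10 * d + γ → dist s 0 ≤ 13 / 10 * d - γ ∧ s ∈ Set.range t))) ∧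
      (∀ t : ↥Literature.Geometry.DiscreteGeometry.hcpKissingPattern → EuclideanSpace ℝ (Fin 3),
        ¬ (0 < d ∧ 0 < γ ∧ η < 1 / 8 ∧
          (∀ u : ↥Literature.Geometry.DiscreteGeometry.hcpKissingPattern, (μ.map fun z : EuclideanSpace ℝ (Fin 3) => z - p) {t u} ≠ 0 ∧ ‖(t u - 0) - d • A (u : EuclideanSpace ℝ (Fin 3))‖ ≤ η * d) ∧
          (∀ s : EuclideanSpace ℝ (Fin 3), (μ.map fun z : EuclideanSpace ℝ (Fin 3) => z - p) {s} ≠ 0 → s ≠ 0 → d ≤ dist s 0) ∧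
          (∃ s : EuclideanSpace ℝ (Fin 3), (μ.map fun z : EuclideanSpace ℝ (Fin 3) => z - p) {s} ≠ 0 ∧ s ≠ 0 ∧ dist s 0 ≤ d) ∧
          (∀ s : EuclideanSpace ℝ (Fin 3), (μ.map fun z : EuclideanSpace ℝ (Fin 3) => z - p) {s} ≠ 0 → s ≠ 0 → dist s 0 < 13 / 10 * d + γ → dist s 0 ≤ 13 / 10 * d - γ ∧ s ∈ Set.range t)))) := by
  intro d η γ A
  obtain ⟨hf, hh⟩ := h d η γ A
  exact ⟨fun t ht => hf (fun u => t u + p) (robustGoodEighth_shift μ p ht),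
    fun t ht => hh (fun u => t u + p) (robustGoodEighth_shift μ p ht)⟩

/-- **THE COARSE-SITE FREQUENCY (clauses (a) + (b) + (d) of `AperiodicFrustratedLawGap`, `let`s VERBATIM).**  For every `δ > 0` and coarse
radius `R₉` there is `C : ℕ` (the packing bound at radius `R₉`) such that for every point-stationary probability law `P`, a.s. rooted
`δ`-hard-core and texture-charged with radii `R₇ R₈ R₉`, and every MEASURABLE set `A` of configurations containing all configurations whose ROOT is
not robustly `1/8`-good (fcc nor hcp): `P A ≥ 1/C`. [folklore] -/
theorem inv_le_prob_coarseRoot :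
    ∀ δ : ℝ, 0 < δ → ∀ R₉ : ℝ, ∃ C : ℕ,
    ∀ P : MeasureTheory.Measure (MeasureTheory.Measure (EuclideanSpace ℝ (Fin 3))), let Gy : ℝ → (N : ℕ) → (Fin N → EuclideanSpace ℝ (Fin 3)) → Fin N → Prop := fun η N y j => let d : ℝ := sInf ((fun z => dist z (y (j : Fin N))) '' (Set.range (y) \ {(y (j : Fin N))})); let T : Set (EuclideanSpace ℝ (Fin 3)) := {z : EuclideanSpace ℝ (Fin 3) | z ∈ Set.range (y) ∧ z ≠ (y (j : Fin N)) ∧ dist z (y (j : Fin N)) < 13 / 10 * d}; ∃ A : EuclideanSpace ℝ (Fin 3) →ₗᵢ[ℝ] EuclideanSpace ℝ (Fin 3), (∃ e : ↥T ≃ ↥Literature.Geometry.DiscreteGeometry.fccKissingPattern, ∀ t : ↥T, dist (d⁻¹ • ((t : EuclideanSpace ℝ (Fin 3)) - (y (j : Fin N)))) (A ((e t : ↥Literature.Geometry.DiscreteGeometry.fccKissingPattern) : EuclideanSpace ℝ (Fin 3))) ≤ η) ∨ (∃ e : ↥T ≃ ↥Literature.Geometry.DiscreteGeometry.hcpKissingPattern,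 ∀ t : ↥T, dist (d⁻¹ • ((t : EuclideanSpace ℝ (Fin 3)) - (y (j : Fin N)))) (A ((e t : ↥Literature.Geometry.DiscreteGeometry.hcpKissingPattern) : EuclideanSpace ℝ (Fin 3))) ≤ η); let TexBall : (N : ℕ) → (Fin N → EuclideanSpace ℝ (Fin 3)) → Fin N → ℝ → ℝ → ℝ → ℝ → Prop := fun N y i R R₇ R₈ R₉ => (∀ a b : Fin N, a ≠ b → (7 : ℝ) / 10 ≤ dist (y a) (y b)) ∧ (∀ j : Fin N, dist (y j) (y i) ≤ R → ¬ Gy (1 / 20) N (y) j) ∧ (∀ j : Fin N, dist (y j) (y i) ≤ R → ¬ ((∀ j' : Fin N, dist (y j') (y j) ≤ R₇ → ¬ Gy (1 / 20) N (y) j') ∧ (∀ z : EuclideanSpace ℝ (Fin 3), dist z (y j) ≤ R₇ → ∃ k : Fin N, dist z (y k) ≤ 1) ∧ (∀ j' : Fin N, dist (y j') (y j) ≤ R₇ → (let d : ℝ := sInf ((fun z => dist z (y j')) '' (Set.range (y) \ {(y j')})); ∀ k : Fin N, y k ≠ y j' → dist (y k) (y j') < 27 / 20 * d → 5 ≤ Nat.card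 {m : Fin N // y m ≠ y j' ∧ dist (y m) (y j') < 27 / 20 * d ∧ y m ≠ y k ∧ dist (y m) (y k) < 27 / 20 * d})))) ∧ (∀ j : Fin N, dist (y j) (y i) ≤ R → ∃ k : Fin N, dist (y k) (y j) ≤ R₈ ∧ Gy (1 / 8) N (y) k) ∧ (∀ j : Fin N, dist (y j) (y i) ≤ R → ¬ ((∀ j' : Fin N, dist (y j') (y j) ≤ R₉ → ¬ Gy (1 / 20) N (y) j') ∧ (Nat.card {j' : Fin N // dist (y j') (y j) ≤ R₉ ∧ ¬ Gy (1 / 8) N (y) j'} : ℝ) ≤ 1 / 2 * (Nat.card {j' : Fin N // dist (y j') (y j) ≤ R₉} : ℝ) ∧ (∀ j' : Fin N, dist (y j') (y j) ≤ R₉ → ¬ Gy (1 / 8) N (y) j' → ¬ (let d : ℝ := sInf ((fun z => dist z (y j')) '' (Set.range (y) \ {(y j')})); ∀ k : Fin N, y k ≠ y j' → dist (y k) (y j') < 27 / 20 * d → 5 ≤ Nat.card {m : Fin N // y m ≠ y j' ∧ dist (y m) (y j') < 27 / 20 * d ∧ y m ≠ y k ∧ dist (y m) (y k) < 27 / 20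 * d})))); let Appr : MeasureTheory.Measure (EuclideanSpace ℝ (Fin 3)) → ℝ → ℝ → ℝ → Prop := fun μ R₇ R₈ R₉ => ∀ q : EuclideanSpace ℝ (Fin 3), μ {q} ≠ 0 → ∀ R ε : ℝ, 0 < ε → ∃ (N : ℕ) (y : Fin N → EuclideanSpace ℝ (Fin 3)) (i : Fin N), TexBall N y i R R₇ R₈ R₉ ∧ (∀ p : EuclideanSpace ℝ (Fin 3), μ {p} ≠ 0 → dist p q ≤ R → ∃ k : Fin N, dist (y k - y i) (p - q) ≤ ε) ∧ (∀ k : Fin N, dist (y k) (y i) ≤ R → ∃ p : EuclideanSpace ℝ (Fin 3), μ {p} ≠ 0 ∧ dist (y k - y i) (p - q) ≤ ε);  MeasureTheory.IsProbabilityMeasure P → (∀ᵐ μ ∂P, Literature.Probability.Process.IsRootedHardCore δ μ) → Literature.Probability.Process.IsPointStationaryLaw P → ∀ R₇ R₈ : ℝ, (∀ᵐ μ ∂P, Appr μ R₇ R₈ R₉) →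
      ∀ A : Set (MeasureTheory.Measure (EuclideanSpace ℝ (Fin 3))), MeasurableSet A →
        (∀ ν : MeasureTheory.Measure (EuclideanSpace ℝ (Fin 3)),
          (∀ (d η γ : ℝ) (A : EuclideanSpace ℝ (Fin 3) →ₗᵢ[ℝ] EuclideanSpace ℝ (Fin 3)),
      (∀ t : ↥Literature.Geometry.DiscreteGeometry.fccKissingPattern → EuclideanSpace ℝ (Fin 3),
        ¬ (0 < d ∧ 0 < γ ∧ η < 1 / 8 ∧
          (∀ u : ↥Literature.Geometry.DiscreteGeometry.fccKissingPattern, ν {t u} ≠ 0 ∧ ‖(t u - 0) - d • A (u : EuclideanSpace ℝ (Fin 3))‖ ≤ η * d) ∧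
          (∀ s : EuclideanSpace ℝ (Fin 3), ν {s} ≠ 0 → s ≠ 0 → d ≤ dist s 0) ∧
          (∃ s : EuclideanSpace ℝ (Fin 3), ν {s} ≠ 0 ∧ s ≠ 0 ∧ dist s 0 ≤ d) ∧
          (∀ s : EuclideanSpace ℝ (Fin 3), ν {s} ≠ 0 → s ≠ 0 → dist s 0 < 13 / 10 * d + γ → dist s 0 ≤ 13 / 10 * d - γ ∧ s ∈ Set.range t))) ∧
      (∀ t : ↥Literature.Geometry.DiscreteGeometry.hcpKissingPattern → EuclideanSpace ℝ (Fin 3),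
        ¬ (0 < d ∧ 0 < γ ∧ η < 1 / 8 ∧
          (∀ u : ↥Literature.Geometry.DiscreteGeometry.hcpKissingPattern, ν {t u} ≠ 0 ∧ ‖(t u - 0) - d • A (u : EuclideanSpace ℝ (Fin 3))‖ ≤ η * d) ∧
          (∀ s : EuclideanSpace ℝ (Fin 3), ν {s} ≠ 0 → s ≠ 0 → d ≤ dist s 0) ∧
          (∃ s : EuclideanSpace ℝ (Fin 3), ν {s} ≠ 0 ∧ s ≠ 0 ∧ dist s 0 ≤ d) ∧
          (∀ s : EuclideanSpace ℝ (Fin 3), ν {s} ≠ 0 → s ≠ 0 → dist s 0 < 13 / 10 * d + γ → dist s 0 ≤ 13 / 10 * d - γ ∧ s ∈ Set.range t)))) → ν ∈ A) →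
        (C : ℝ≥0∞)⁻¹ ≤ P A := by
  intro δ hδ R₉
  obtain ⟨C, hC⟩ := measure_univ_le_mul_of_ubiquitous hδ R₉
  refine ⟨C, fun P => ?_⟩
  dsimp only
  intro hP ha hb R₇ R₈ hd A hA hhull
  have hcoarse := ae_coarse_near_of_texture P
  dsimp only at hcoarse
  have hc := hcoarse δ hδ ha R₇ R₈ R₉ hd
  have hub : ∀ᵐ μ ∂P, ∃ x : EuclideanSpace ℝ (Fin 3), μ {x} ≠ 0 ∧ ‖x‖ ≤ R₉ ∧ μ.map (fun z : EuclideanSpace ℝ (Fin 3) => z - x) ∈ A := by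
    filter_upwards [ha, hc] with μ hμ hμc
    have h0 : μ {0} ≠ 0 := by
      obtain ⟨S, h0S, -, rfl⟩ := hμ
      exact (count_restrict_singleton_ne_zero_iff S 0).2 h0S
    obtain ⟨p₁, hp₁, hp₁R, hN⟩ := hμc 0 h0
    exact ⟨p₁, hp₁, by rwa [← dist_zero_right], hhull _ (notRobustGoodEighth_reroot hN)⟩
  have h := hC P ha hb A hA hub
  rw [measure_univ] at h
  rw [← one_div]
  exact ENNReal.div_le_of_le_mul (by rwa [mul_comm] at h)

end Summit.AtomisticToContinuum.Crystallization.Theorems.FrustratedLawDichotomyTextureCoarseSites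

end
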